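import Literature.AlgebraicGeometry.Resolution.AlterationsReductionHolds
import Literature.AlgebraicGeometry.Resolution.AlterationsFibrations
import Literature.AlgebraicGeometry.Resolution.StrictNormalCrossingsPoints
import Literature.AlgebraicGeometry.Resolution.FiniteBirationalNormal
import Literature.Topology.KrullDimZero
import Literature.Topology.KrullDimensionDrop
import Mathlib.RingTheory.DedekindDomain.Dvr
import HarnessLib

/-!
# De Jong's alteration theorem: the case `dim X = 1` (de Jong 1996, 4.3)

Topic: `Literature/AlgebraicGeometry/Resolution`. De Jong 1996, 4.3 (p. 66):

> "4.3. We argue by induction on `d = dim X`. The case `dim X = 0` is all right. (And so is the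
> case `dim X = 1`, as we see by taking `X₁` to be the normalization of `X`. However, this does
> not give the result of Remark 4.2. To get this see 4.5.)"

The tree runs the printed induction for the STRONG statement (Thm. 4.1 (i)+(ii) with its
generically-étale clause, `DeJong1996.StatementUpToDim`) from the base case `dim X = 0`
(`DeJong1996.statementUpToDim_zero`, `AlterationsStrong.lean`) through the induction step
`DeJong1996InductionStep`, itself cut into the preliminary reductions 4.6–4.10
(`DeJong1996NormalProjectiveReduction`, PROVED: `DeJong1996NormalProjectiveReduction_holds`,
`AlterationsReductionHolds.lean`) and the step for normal projective pairs 4.11–4.28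
(`DeJong1996NormalProjectiveStep`, a named fact quantified over ALL `d ≥ 0`, i.e. `dim X ≥ 1`).
The printed argument of 4.11–4.28 (`f : X' → ℙ^{d-1}`, …) is only run for `dim X ≥ 2`; for
curves the theorem is the parenthetical remark of 4.3 quoted above. This file PROVES that remark
in the strong form, closing the instance `d = 0` (`dim X = 1`) of the step facts and giving
Thm. 4.1 for curves over algebraically closed fields unconditionally:

* `DeJong1996.NormalProjectivePair.conclusionGenericallyEtale_of_dim_le_one` — a normal
  projective pair `(X, Z)` with `dim X ≤ 1` satisfies the conclusion of Thm. 4.1 with the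
  identity as alteration: a normal Noetherian integral scheme of dimension `≤ 1` is regular
  (its local rings are fields or discrete valuation rings,
  `Scheme.IsRegular.of_isIntegrallyClosed_of_dim_le_one`), and a proper closed subset `Z` of
  an integral Noetherian scheme of dimension `≤ 1` is a finite set of closed points
  (`Set.finite_and_isClosed_singleton_of_dim_le_one`) with discrete valuation rings as local
  rings, hence a strict normal crossings divisor
  (`isStrictNormalCrossingsDivisor_of_dim_le_one`, via
  `IsStrictNormalCrossingsDivisor.of_isolated_of_isDiscreteValuationRing`).
* `DeJong1996.normalProjectiveStep_zero`, `DeJong1996.normalProjectiveStepVI_zero` — the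
  instances `d = 0` of `DeJong1996NormalProjectiveStep` (`AlterationsInduction.lean`) and
  `DeJong1996NormalProjectiveStepVI` (`AlterationsFibrations.lean`), PROVED.
* `DeJong1996.statementUpToDim_one` — **Thm. 4.1 (i)+(ii) with its generically-étale clause
  for all pairs `(X, Z)` with `dim X ≤ 1` over an algebraically closed field**, PROVED from
  `DeJong1996NormalProjectiveReduction_holds` (4.6–4.10: Chow, projective closure, blowing up
  `Z`, normalisation) and the first item; `DeJong1996.inductionStep_zero` is the instance
  `d = 0` of `DeJong1996InductionStep`.

## Sources

* A. J. de Jong, *Smoothness, semi-stability and alterations*, Publ. Math. IHÉS 83 (1996)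
  51–93: 2.4 (p. 55), Thm. 4.1, 4.3 (p. 66), 4.6–4.10 (pp. 66–67).
* Q. Liu, *Algebraic Geometry and Arithmetic Curves*, OUP 2002: Def. 4.1.1, Prop. 4.1.12
  (normal Noetherian of dimension `≤ 1` ⟹ Dedekind / regular), Ex. 4.1.9.
* The Stacks Project, Tags 0BI9 (strict normal crossings), 034X (normal ⟹ regular in
  codimension 1).
-/

noncomputable section

open CategoryTheory AlgebraicGeometry TopologicalSpace Topology

namespace Literature.AlgebraicGeometry.Resolution

universe u

/-! ## Topology: Noetherian spaces of dimension `≤ 0` are finite; proper closed subsets of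
irreducible spaces of dimension `≤ 1` -/

/-- A Noetherian `T₀` space of topological Krull dimension `≤ 0` is finite: every irreducible
closed subset is maximal, so each point is its own irreducible component, and there are only
finitely many irreducible components. [folklore] -/
theorem finite_of_noetherianSpace_of_topologicalKrullDim_le_zero (Z : Type*) [TopologicalSpace Z]
    [T0Space Z] [NoetherianSpace Z] (h : topologicalKrullDim Z ≤ 0) : Finite Z := by
  have hmax : ∀ A : IrreducibleCloseds Z, IsMax A := Order.krullDim_nonpos_iff_forall_isMax.mp h
  have hsingle : ∀ z : Z, irreducibleComponent z = {z} := by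
    intro z
    have hcl : closure ({z} : Set Z) = {z} := by
      refine Set.Subset.antisymm (fun w hw => ?_) subset_closure
      rw [Set.mem_singleton_iff]
      exact (Literature.Topology.eq_of_specializes_of_topologicalKrullDim_le_zero h
        (specializes_iff_mem_closure.mpr hw)).symm
    let A : IrreducibleCloseds Z := ⟨{z}, isIrreducible_singleton, hcl ▸ isClosed_closure⟩
    let B : IrreducibleCloseds Z :=
      ⟨irreducibleComponent z, isIrreducible_irreducibleComponent, isClosed_irreducibleComponent⟩
    have hAB : A ≤ B := by
      change ({z} : Set Z) ⊆ irreducibleComponent z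
      exact Set.singleton_subset_iff.mpr mem_irreducibleComponent
    have hBA : B ≤ A := hmax A hAB
    exact Set.Subset.antisymm hBA hAB
  have hfin : (irreducibleComponents Z).Finite := NoetherianSpace.finite_irreducibleComponents
  have hsub : Set.range (fun z : Z => ({z} : Set Z)) ⊆ irreducibleComponents Z := by
    rintro _ ⟨z, rfl⟩
    change ({z} : Set Z) ∈ irreducibleComponents Z
    rw [← hsingle z]
    exact irreducibleComponent_mem_irreducibleComponents z
  have hinj : Function.Injective (fun z : Z => ({z} : Set Z)) := fun a b hab =>
    Set.singleton_eq_singleton_iff.mp hab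
  haveI := (hfin.subset hsub).to_subtype
  exact Finite.of_injective_finite_range hinj

/-- A subset of topological Krull dimension `≤ 0` (subspace topology) of a Noetherian `T₀` space
is finite. [folklore] -/
theorem Set.finite_of_topologicalKrullDim_le_zero {X : Type*} [TopologicalSpace X] [T0Space X]
    [NoetherianSpace X] {Z : Set X} (h : topologicalKrullDim Z ≤ 0) : Z.Finite :=
  haveI := finite_of_noetherianSpace_of_topologicalKrullDim_le_zero Z h
  Set.toFinite Z

/-- **A proper closed subset of an irreducible sober Noetherian `T₀` space of dimension `≤ 1` is
a finite set of closed points** (its dimension is `< 1`, `Literature.Topology.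
topologicalKrullDim_lt_of_isClosed_ssubset`, so it has no proper specialisations and is finite).
[folklore] -/
theorem Set.finite_and_isClosed_singleton_of_dim_le_one {X : Type*} [TopologicalSpace X]
    [QuasiSober X] [T0Space X] [IrreducibleSpace X] [NoetherianSpace X]
    (hdim : topologicalKrullDim X ≤ 1) {Z : Set X} (hZ : IsClosed Z) (hZ' : Z ≠ Set.univ) :
    Z.Finite ∧ ∀ p ∈ Z, IsClosed ({p} : Set X) := by
  have hlt : topologicalKrullDim Z < ((1 : ℕ) : WithBot ℕ∞) := by
    refine Literature.Topology.topologicalKrullDim_lt_of_isClosed_ssubset hZ hZ' 1 ?_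
    exact lt_of_le_of_lt hdim (by exact_mod_cast WithBot.coe_lt_coe.mpr (by decide))
  have h0 : topologicalKrullDim Z ≤ 0 := by
    -- `dim Z < 1` in `WithBot ℕ∞` means `dim Z ≤ 0`
    have h1 : topologicalKrullDim Z < 1 := by exact_mod_cast hlt
    rw [← zero_add (1 : WithBot ℕ∞), ← Nat.cast_zero, ENat.WithBot.lt_add_one_iff] at h1
    rwa [← Nat.cast_zero]
  exact ⟨Set.finite_of_topologicalKrullDim_le_zero h0, fun p hp =>
    Literature.Topology.Set.isClosed_singleton_of_topologicalKrullDim_le_zero hZ h0 hp⟩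

/-- Every point of a proper closed subset `Z` of an irreducible sober Noetherian `T₀` space of
dimension `≤ 1` is isolated in `Z`: some open meets `Z` in that point only. [folklore] -/
theorem Set.exists_isOpen_inter_eq_singleton_of_dim_le_one {X : Type*} [TopologicalSpace X]
    [QuasiSober X] [T0Space X] [IrreducibleSpace X] [NoetherianSpace X]
    (hdim : topologicalKrullDim X ≤ 1) {Z : Set X} (hZ : IsClosed Z) (hZ' : Z ≠ Set.univ)
    {p : X} (hp : p ∈ Z) : ∃ U : Set X, IsOpen U ∧ p ∈ U ∧ U ∩ Z = {p} := by
  obtain ⟨hfin, hcl⟩ := Set.finite_and_isClosed_singleton_of_dim_le_one hdim hZ hZ'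
  have hc : IsClosed (Z \ {p}) := by
    rw [← Set.biUnion_of_singleton (Z \ {p})]
    exact (hfin.subset Set.sdiff_subset).isClosed_biUnion fun z hz => hcl z hz.1
  refine ⟨(Z \ {p})ᶜ, hc.isOpen_compl, fun h => h.2 rfl, ?_⟩
  ext x
  simp only [Set.mem_inter_iff, Set.mem_compl_iff, Set.mem_sdiff, Set.mem_singleton_iff,
    not_and, not_not]
  constructor
  · rintro ⟨h1, h2⟩
    exact h1 h2
  · rintro rfl
    exact ⟨fun _ => rfl, hp⟩

/-! ## Algebra: normal integral Noetherian schemes of dimension `≤ 1` are Dedekind schemes -/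

section Dedekind

variable {X : Scheme.{u}} [IsIntegral X] [IsLocallyNoetherian X]

/-- The ring of sections over a non-empty affine open of a normal integral locally Noetherian
scheme of dimension `≤ 1` is a Dedekind domain (Noetherian, integrally closed —
`isIntegrallyClosed_sections_of_stalk` — of Krull dimension `≤ 1`; Liu 2002, Def. 4.1.1 /
Prop. 4.1.12). [folklore] -/
theorem isDedekindDomain_sections_of_dim_le_one
    (hN : ∀ x : X, IsIntegrallyClosed (X.presheaf.stalk x)) (hdim : topologicalKrullDim X ≤ 1)
    (U : X.affineOpens) [Nonempty (U : X.Opens)] : IsDedekindDomain Γ(X, U) := by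
  haveI : IsNoetherianRing Γ(X, U) := IsLocallyNoetherian.component_noetherian U
  haveI : IsIntegrallyClosed Γ(X, U) := isIntegrallyClosed_sections_of_stalk hN U
  haveI : Ring.DimensionLEOne Γ(X, U) :=
    Ring.DimensionLEOne.of_ringKrullDim_le_one (ringKrullDim_le_of_isAffineOpen X U.2 hdim)
  exact (isDedekindDomain_iff _ (FractionRing Γ(X, U))).mpr
    ⟨inferInstance, inferInstance, inferInstance, fun hx => IsIntegrallyClosed.isIntegral_iff.mp hx⟩

/-- **A normal integral locally Noetherian scheme of dimension `≤ 1` is regular** (its local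
rings are localisations of Dedekind domains, i.e. fields or discrete valuation rings; Liu 2002,
Prop. 4.1.12, Ex. 4.1.9; Stacks 034X). This is why "the case `dim X = 1`" of de Jong 1996,
Thm. 4.1 is settled "by taking `X₁` to be the normalization of `X`" (loc. cit. 4.3).
[cite: DeJong1996, 4.3, p. 66] -/
theorem Scheme.IsRegular.of_isIntegrallyClosed_of_dim_le_one
    (hN : ∀ x : X, IsIntegrallyClosed (X.presheaf.stalk x)) (hdim : topologicalKrullDim X ≤ 1) :
    Scheme.IsRegular X := by
  intro x
  obtain ⟨_, ⟨U, hU, rfl⟩, hxU, -⟩ :=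
    X.isBasis_affineOpens.exists_subset_of_mem_open (Set.mem_univ x) isOpen_univ
  haveI : Nonempty U := ⟨⟨x, hxU⟩⟩
  haveI : IsDedekindDomain Γ(X, U) := isDedekindDomain_sections_of_dim_le_one hN hdim ⟨U, hU⟩
  letI := X.presheaf.algebra_section_stalk (⟨x, hxU⟩ : U)
  haveI := hU.isLocalization_stalk ⟨x, hxU⟩
  exact IsRegularLocalRing.of_ringEquiv (IsLocalization.algEquiv
    (hU.primeIdealOf ⟨x, hxU⟩).asIdeal.primeCompl
    (Localization.AtPrime (hU.primeIdealOf ⟨x, hxU⟩).asIdeal)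
    (X.presheaf.stalk ((⟨x, hxU⟩ : U) : X))).toRingEquiv

/-- On a normal integral locally Noetherian scheme of dimension `≤ 1`, the local ring at every
point other than the generic point is a discrete valuation ring (the localisation of a Dedekind
domain at a non-zero prime). [folklore] -/
theorem isDiscreteValuationRing_stalk_of_dim_le_one
    (hN : ∀ x : X, IsIntegrallyClosed (X.presheaf.stalk x)) (hdim : topologicalKrullDim X ≤ 1)
    {p : X} (hp : p ≠ genericPoint X) : IsDiscreteValuationRing (X.presheaf.stalk p) := by
  obtain ⟨_, ⟨U, hU, rfl⟩, hpU, -⟩ :=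
    X.isBasis_affineOpens.exists_subset_of_mem_open (Set.mem_univ p) isOpen_univ
  haveI : Nonempty U := ⟨⟨p, hpU⟩⟩
  haveI : IsDedekindDomain Γ(X, U) := isDedekindDomain_sections_of_dim_le_one hN hdim ⟨U, hU⟩
  letI := X.presheaf.algebra_section_stalk (⟨p, hpU⟩ : U)
  haveI := hU.isLocalization_stalk ⟨p, hpU⟩
  have hP : (hU.primeIdealOf ⟨p, hpU⟩).asIdeal ≠ ⊥ := by
    intro h0
    apply hp
    have hηU : genericPoint X ∈ U :=
      ((genericPoint_spec X).mem_open_set_iff U.isOpen).mpr (by simpa using ‹Nonempty U›)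
    have h1 : hU.primeIdealOf ⟨p, hpU⟩ = hU.primeIdealOf ⟨genericPoint X, hηU⟩ := by
      rw [hU.primeIdealOf_genericPoint, genericPoint_eq_bot_of_affine]
      exact PrimeSpectrum.ext h0
    have h2 := congrArg hU.fromSpec h1
    rwa [hU.fromSpec_primeIdealOf, hU.fromSpec_primeIdealOf] at h2
  exact IsLocalization.AtPrime.isDiscreteValuationRing_of_dedekind_domain Γ(X, U) hP
    (X.presheaf.stalk ((⟨p, hpU⟩ : U) : X))

/-- **A proper closed subset of a normal integral Noetherian scheme of dimension `≤ 1` is a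
strict normal crossings divisor** (de Jong 1996, 2.4 with `r = 1`, `e = 0` at each of its
finitely many closed points, whose local rings are discrete valuation rings;
`IsStrictNormalCrossingsDivisor.of_isolated_of_isDiscreteValuationRing`). This is the shape of
the boundary `j₁(φ₁⁻¹(Z)) ∪ X̄₁ ∖ j₁(X₁)` of Thm. 4.1 for `dim X = 1` (loc. cit. 4.3).
[cite: DeJong1996, 2.4 and 4.3, pp. 55, 66] -/
theorem isStrictNormalCrossingsDivisor_of_dim_le_one [CompactSpace X]
    (hN : ∀ x : X, IsIntegrallyClosed (X.presheaf.stalk x)) (hdim : topologicalKrullDim X ≤ 1)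
    {Z : Set X} (hZ : IsClosed Z) (hZ' : Z ≠ Set.univ) : IsStrictNormalCrossingsDivisor X Z := by
  haveI : IsNoetherian X := {}
  refine IsStrictNormalCrossingsDivisor.of_isolated_of_isDiscreteValuationRing hZ ?_ ?_
  · intro p hp
    obtain ⟨U, hU, hpU, hUZ⟩ := Set.exists_isOpen_inter_eq_singleton_of_dim_le_one hdim hZ hZ' hp
    exact ⟨⟨U, hU⟩, hpU, hUZ⟩
  · intro p hp
    have hpη : p ≠ genericPoint X := by
      rintro rfl
      exact hZ' (Set.eq_univ_of_forall fun x =>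
        ((genericPoint_spec X).specializes (Set.mem_univ x)).mem_closed hZ hp)
    exact ⟨inferInstance, isDiscreteValuationRing_stalk_of_dim_le_one hN hdim hpη⟩

end Dedekind

/-! ## De Jong 1996, 4.3: the case `dim X = 1` of Theorem 4.1 -/

namespace DeJong1996

/-- **A normal projective pair of dimension `≤ 1` satisfies the conclusion of Thm. 4.1, with its
generically-étale clause, through the identity** (de Jong 1996, 4.3: "so is the case
`dim X = 1`, as we see by taking `X₁` to be the normalization of `X`"; here `X` is already
normal): `X` is a regular projective variety and `Z`, a proper closed subset, is a finite set of
closed points with discrete valuation rings as local rings, i.e. a strict normal crossings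
divisor. [cite: DeJong1996, 4.3, p. 66] -/
theorem NormalProjectivePair.conclusionGenericallyEtale_of_dim_le_one {k : Type u} [Field k]
    {X : Scheme.{u}} {f : X ⟶ Spec (.of k)} {Z : Set X} (h : NormalProjectivePair f Z)
    (hdim : topologicalKrullDim X ≤ 1) : ConclusionGenericallyEtale f Z := by
  haveI := h.isIntegral
  haveI := h.locallyOfFiniteType
  haveI := h.quasiCompact
  haveI : IsLocallyNoetherian X := LocallyOfFiniteType.isLocallyNoetherian f
  haveI : CompactSpace X := QuasiCompact.compactSpace_of_compactSpace f
  have hset : (𝟙 X : X ⟶ X) '' ((𝟙 X : X ⟶ X) ⁻¹' Z) ∪ (Set.range (𝟙 X : X ⟶ X))ᶜ = Z := by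
    ext x
    simp
  refine ⟨X, X, 𝟙 X, 𝟙 X, f, (isPurelyInseparableAlteration_id X).isAlteration, inferInstance,
    inferInstance, h.isProjectiveOver,
    Scheme.IsRegular.of_isIntegrallyClosed_of_dim_le_one h.isIntegrallyClosed hdim, rfl, ?_,
    IsGenericallyEtale.of_etale _⟩
  rw [hset]
  exact isStrictNormalCrossingsDivisor_of_dim_le_one h.isIntegrallyClosed hdim h.isClosed
    h.ne_univ

/-- **The instance `d = 0` (`dim X = 1`) of `DeJong1996NormalProjectiveStep`** (4.11–4.28 for
normal projective curves), PROVED — by 4.3 rather than by the printed 4.11–4.28, which operate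
in dimension `≥ 2`. [cite: DeJong1996, 4.3, p. 66] -/
theorem normalProjectiveStep_zero (k : Type u) [Field k] (_ih : StatementUpToDim k 0)
    (X : Scheme.{u}) (f : X ⟶ Spec (.of k)) (Z : Set X) (hP : NormalProjectivePair f Z)
    (hdim : topologicalKrullDim X = ((0 + 1 : ℕ) : WithBot ℕ∞)) :
    ConclusionGenericallyEtale f Z :=
  hP.conclusionGenericallyEtale_of_dim_le_one (by rw [hdim]; exact_mod_cast le_rfl)

/-- **The instance `d = 0` (`dim X = 1`) of `DeJong1996NormalProjectiveStepVI`** (4.13–4.28 for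
pairs in situation (vi) of dimension `1`), PROVED by 4.3. [cite: DeJong1996, 4.3, p. 66] -/
theorem normalProjectiveStepVI_zero (k : Type u) [Field k] (_ih : StatementUpToDim k 0)
    (X : Scheme.{u}) (fX : X ⟶ Spec (.of k)) (Z : Set X) (hVI : SituationVI fX Z)
    (hdim : topologicalKrullDim X = ((0 + 1 : ℕ) : WithBot ℕ∞)) :
    ConclusionGenericallyEtale fX Z :=
  normalProjectiveStep_zero k _ih X fX Z hVI.normalProjectivePair hdim

/-- **Theorem 4.1 for curves over an algebraically closed field** (de Jong 1996, 4.3 with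
4.6–4.10): Thm. 4.1 (i)+(ii) with its generically-étale clause holds for every pair `(X, Z)`
over an algebraically closed field `k` with `dim X ≤ 1` — reduce to normal projective pairs of
the same dimension (`DeJong1996NormalProjectiveReduction_holds`: Chow's lemma, projective
closure, blowing up `Z`, normalisation) and take the identity there
(`NormalProjectivePair.conclusionGenericallyEtale_of_dim_le_one`). Unconditional.
[cite: DeJong1996, 4.3, p. 66] -/
theorem statementUpToDim_one (k : Type u) [Field k] [IsAlgClosed k] : StatementUpToDim k 1 := by
  intro X f Z hs hl hq hi hdim hZ hZ'
  refine DeJong1996NormalProjectiveReduction_holds k X f Z hs hl hq hi hZ hZ'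
    fun X' f' Z' hP hdimX' => ?_
  exact hP.conclusionGenericallyEtale_of_dim_le_one (by rw [hdimX']; exact_mod_cast hdim)

/-- The instance `d = 0` of `DeJong1996InductionStep`, PROVED. [cite: DeJong1996, 4.3, p. 66] -/
theorem inductionStep_zero (k : Type u) [Field k] [IsAlgClosed k] (_ih : StatementUpToDim k 0) :
    StatementUpToDim k (0 + 1) :=
  statementUpToDim_one k

/-- Theorem 4.1 for curves over an algebraically closed field, spelled out: for a variety `X`
over `k = k̄` with `dim X ≤ 1` and a proper closed subset `Z ⊂ X` there are a generically étale
alteration `φ₁ : X₁ → X` and an open immersion `j₁ : X₁ → X̄₁` over `k` into a regular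
projective variety `X̄₁` with `j₁(φ₁⁻¹(Z)) ∪ X̄₁ ∖ j₁(X₁)` a strict normal crossings divisor.
[cite: DeJong1996, Thm. 4.1 and 4.3, p. 66] -/
theorem conclusionGenericallyEtale_of_dim_le_one {k : Type u} [Field k] [IsAlgClosed k]
    {X : Scheme.{u}} (f : X ⟶ Spec (.of k)) [IsSeparated f] [LocallyOfFiniteType f]
    [QuasiCompact f] [IsIntegral X] (hdim : topologicalKrullDim X ≤ 1) {Z : Set X}
    (hZ : IsClosed Z) (hZ' : Z ≠ Set.univ) : ConclusionGenericallyEtale f Z :=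
  statementUpToDim_one k X f Z ‹_› ‹_› ‹_› ‹_› hdim hZ hZ'

end DeJong1996

end Literature.AlgebraicGeometry.Resolution

end
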